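import Summits.BirchSwinnertonDyer.BirchSwinnertonDyer.Theorems.CMKolyvaginAtInertTwoPairMemberCanonicalAtTwo
import Summits.BirchSwinnertonDyer.BirchSwinnertonDyer.Theorems.CMKolyvaginAtInertTwoShaCountRankFiniteAtTwo
import HarnessLib

/-!
# Route `CMKolyvaginAtInertTwo`, crux `CMKolyvaginExactAtInertTwo` (stmt-BirchSwinnertonDyer-24277):
# T2 input (iii) — the annihilator binders `hkill` of the record-free member formulas DISCHARGED on the
# habitat from FINITENESS of `Ш(E/ℚ)` and `Ш(E^{(d_K)}/ℚ)` (Gross–Zagier–Kolyvagin facts), no Čebotarev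

Seat `bsd-line-cmk2-p1` g16 (cell `bsd-print-cf2`); helper (`--supports stmt-BirchSwinnertonDyer-24277`).
THEOREMS ONLY: no definition, no named fact, no `sorry`; the route's published inputs (Gross–Zagier at all
levels, GZK, modularity — items 24148/19921/19273) are HYPOTHESES; no item is closed; BSD is not proved.

`hV₁/hV₂_canonical_of_kill` (`…PairMemberCanonicalAtTwo`, this seat) display
`hkill : Ш[2^{2L}] ⊆ Ш[2^L]` for `E` and for the twin `E^{(d_K)} = twin W K`, and
`zsmul_pow_eq_zero_of_finite_of_padicValNat_le` turns that into «`Ш` finite with `v₂(#Ш) ≤ L`». Seat g15's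
`ShaCountTwo.rank_add_eq_one_and_finite_sha_of_heegnerData_of_facts` gives the finiteness of BOTH `Ш(W)` and
`Ш(Wd)` for every model `Wd` of the twist from a Heegner datum with `y_K = P(1)` of infinite order (no CM, no
sign, no image hypothesis). Composed:

* `finite_sha_and_twin_of_heegnerData_of_facts` — `Finite Ш(W) ∧ Finite Ш(twin W K)`;
* `exists_kill_level_of_heegnerData_of_facts` — `∃ L₀, ∀ L ≥ L₀`, `hkill` holds for `W` AND for `twin W K`
  (take `L₀ = max (v₂ #Ш(W)) (v₂ #Ш(twin W K))`).

References: [GrossZagier1986] I (6.3); [Kolyvagin1990] Thm. A (via the tree's GZK fact); [McCallumLMS1991] §5.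
-/

-- single-conjunct summit: `Summit.BirchSwinnertonDyer.BirchSwinnertonDyer.…` repeats the name by design
set_option linter.dupNamespace false
set_option autoImplicit false

noncomputable section

open scoped Classical

open WeierstrassCurve NumberField Literature.NumberTheory.EllipticCurves
  Literature.NumberTheory.EllipticCurves.ModularForms
open Summit.BirchSwinnertonDyer.BirchSwinnertonDyer.Theorems.GenusExact.VisiblePairAtTwo (twin)
open Summit.BirchSwinnertonDyer.BirchSwinnertonDyer.Theorems.ShaCountTwo

namespace Summit.BirchSwinnertonDyer.BirchSwinnertonDyer.Theorems.KolyvaginPairDataTwo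

variable (hGZ : ∀ (N : ℕ) [NeZero N] (W : WeierstrassCurve ℚ) (K : Type) [Field K] [NumberField K],
    gross_zagier N W K)
  (hGZK : rank_eq_analyticRank_of_analyticRank_le_one) (hmod : hasEntireLFunction_rat)
  (W : WeierstrassCurve ℚ) [W.IsElliptic] [W.IsGloballyMinimal] [NeZero (W.conductorNorm ℤ)]
  (K : Type) [Field K] [NumberField K] (hK : IsImaginaryQuadratic K)
  (hH : SatisfiesHeegnerHypothesis (W.conductorNorm ℤ) K)
  (Dt : ModularParametrizationData W (W.conductorNorm ℤ)) (β : ℤ) (ι : K →+* ℂ)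
  (d₁ : KolyvaginHeegnerData Dt β ι 1) (hy : ¬ IsOfFinAddOrder d₁.derivedPoint)
  [(twin W K).IsElliptic]

include hGZ hGZK hmod hK hH hy

/-- **`Ш(E/ℚ)` and `Ш(E^{(d_K)}/ℚ)` (gk2's model `twin W K`) are finite** from a Heegner datum with `y_K`
of infinite order, modulo Gross–Zagier (all levels), GZK and modularity — seat g15's
`rank_add_eq_one_and_finite_sha_of_heegnerData_of_facts` at the model `twin W K = W.quadraticTwist d_K`
(variable change `1`). [cite: GrossZagier1986, Thm. I.(6.3)] [cite: McCallumLMS1991, §1 (Kolyvagin's theorem)] -/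
theorem finite_sha_and_twin_of_heegnerData_of_facts : Finite W.sha ∧ Finite (twin W K).sha := by
  obtain ⟨-, h₁, h₂⟩ := rank_add_eq_one_and_finite_sha_of_heegnerData_of_facts hGZ hGZK hmod W K hK hH Dt β ι
    d₁ hy (twin W K) ⟨1, one_smul _ _⟩
  exact ⟨h₁, h₂⟩

/-- **The annihilator binders `hkill` of `hV₁/hV₂_canonical_of_kill` on the habitat, from finiteness**: there is
`L₀` (e.g. `max (v₂ #Ш(W)) (v₂ #Ш(twin W K))`) such that for every `L ≥ L₀`, `Ш(W)[2^{2L}] ⊆ Ш(W)[2^L]` and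
`Ш(twin W K)[2^{2L}] ⊆ Ш(twin W K)[2^L]`. No Čebotarev, no Kolyvagin annihilator.
[cite: McCallumLMS1991, §5 Thm. 5.4 (proof)] [cite: GrossZagier1986, Thm. I.(6.3)] -/
theorem exists_kill_level_of_heegnerData_of_facts :
    ∃ L₀ : ℕ, ∀ L : ℕ, L₀ ≤ L →
      (∀ a ∈ W.sha, ((2 : ℤ) ^ (2 * L)) • a = 0 → ((2 : ℤ) ^ L) • a = 0) ∧
      (∀ a ∈ (twin W K).sha, ((2 : ℤ) ^ (2 * L)) • a = 0 → ((2 : ℤ) ^ L) • a = 0) := by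
  obtain ⟨h₁, h₂⟩ := finite_sha_and_twin_of_heegnerData_of_facts hGZ hGZK hmod W K hK hH Dt β ι d₁ hy
  haveI := h₁
  haveI := h₂
  refine ⟨max (padicValNat 2 (Nat.card W.sha)) (padicValNat 2 (Nat.card (twin W K).sha)), fun L hL ↦ ⟨?_, ?_⟩⟩
  · exact zsmul_pow_eq_zero_of_finite_of_padicValNat_le W.sha ((le_max_left _ _).trans hL)
  · exact zsmul_pow_eq_zero_of_finite_of_padicValNat_le (twin W K).sha ((le_max_right _ _).trans hL)

end Summit.BirchSwinnertonDyer.BirchSwinnertonDyer.Theorems.KolyvaginPairDataTwo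

end
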